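import Mathlib.Topology.Algebra.OpenSubgroup
import Literature.AnabelianGeometry.SemiGraphs.GraphOfAnabelioids

/-!
# [SemiAnbd] Remark 2.2.1: the universal pro-finite étale covering and stabilizers (p. 24)

Mochizuki, *Semi-graphs of anabelioids*, Publ. RIMS **42** (2006) 221–322, §2, Remark 2.2.1,
author's manuscript p. 24 [cite: MochizukiSemiAnbd2006, Rem. 2.2.1 p.24]: "by considering
collections of normal open subgroups of `Π_𝒢` whose intersection is trivial, one may think of `Π_𝒢`
as acting on a “universal pro-finite étale covering” of `𝒢`.  In particular, `Π_𝒢` acts naturally on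
the underlying “pro-semi-graph” of this “universal pro-finite étale covering”.  Moreover, it follows
immediately from the definitions [cf. … [Serre], Chapter I, p. 51] that the image of each `Π_v`
(respectively, `Π_b`) in `Π_𝒢` is equal to the stabilizer of a compatible system of vertices
(respectively, edges) of this pro-semi-graph."

Rendering (additive note).  For an open normal subgroup `N ⊆ Π_𝒢` the finite étale Galois covering
`𝒢_N → 𝒢` attached to the `Π_𝒢`-set `Π_𝒢/N` (Def. 2.2 (i); its semi-graph-level construction is the
named fact `exists_finiteEtaleCovering` of `Coverticial.lean`) has, over the vertex `v` (resp. the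
edge of the branch `b`), vertices (resp. edges) = the orbits of the image of `Π_v` (resp. `Π_b`) on
`Π_𝒢/N`; the "pro-semi-graph" is the inverse system of these underlying semi-graphs over the open
normal `N`, the compatible system singled out by the base vertex is `(Π_v N/N)_N`, and its
stabilizer is `⋂_N Π_v·N`.  Under this dictionary the displayed assertion is the statement recorded
below (for every basepoint through `v`, resp. induced from `𝒢_e`): the image of `Π_v` (resp. `Π_b`)
in `Π_𝒢` equals `⋂_N (image·N)` over all open normal subgroups `N` — NAMED FACT (it amounts to the
closedness of these images, `Π_v`, `Π_b` being profinite and the maps continuous).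
-/

namespace Literature.AnabelianGeometry.SemiGraphs

open CategoryTheory CategoryTheory.PreGaloisCategory
open Literature.AnabelianGeometry.Anabelioids

universe v₁ u₁ u

namespace SemiGraphOfAnabelioids

/-- The *stabilizer of the compatible system* `(K·N/N)_N` of the pro-object `(Π/N)_N` (open normal
`N ⊆ Π`) determined by a subgroup `K ⊆ Π`: `⋂_N K·N` ([SemiAnbd] Rmk 2.2.1, "stabilizer of a
compatible system of vertices … of this pro-semi-graph"). [cite: MochizukiSemiAnbd2006, Rem. 2.2.1 p.24] -/
def proStabilizer {Γ : Type*} [Group Γ] [TopologicalSpace Γ] (K : Subgroup Γ) : Subgroup Γ :=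
  ⨅ (N : OpenNormalSubgroup Γ), K ⊔ (N : Subgroup Γ)

/-- NAMED FACT, [SemiAnbd] Remark 2.2.1 (in the rendering of the module docstring): for a connected
semi-graph of anabelioids `𝒢`, "the image of each `Π_v` (respectively, `Π_b`) in `Π_𝒢` is equal to
the stabilizer of a compatible system of vertices (respectively, edges) of this pro-semi-graph" —
the image of `Π_v → Π_𝒢` (resp. `Π_b → Π_𝒢`) equals the stabilizer `⋂_N (image)·N` of the system
it fixes. [cite: MochizukiSemiAnbd2006, Rem. 2.2.1 p.24] -/
def remark_2_2_1 : Prop :=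
  ∀ (𝒢 : SemiGraphOfAnabelioids.{v₁, u₁, u}), 𝒢.IsConnected →
    (∀ (v : 𝒢.graph.Vertex) (F : 𝒢.V v ⥤ FintypeCat.{v₁}) [FiberFunctor F],
      proStabilizer (𝒢.piVToPi v F).range = (𝒢.piVToPi v F).range) ∧
    ∀ (b : 𝒢.graph.Branch) (v : 𝒢.graph.Vertex) (h : 𝒢.graph.abuts b = some v)
      (F : 𝒢.E (𝒢.graph.edgeOf b) ⥤ FintypeCat.{v₁}) [FiberFunctor F],
      proStabilizer (𝒢.piBToPi b v h F).range = (𝒢.piBToPi b v h F).range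

end SemiGraphOfAnabelioids

end Literature.AnabelianGeometry.SemiGraphs
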